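import Literature.MathematicalPhysics.QuantumFieldTheory.OSDistributionSpacePowers
import Literature.Analysis.OperatorTheory.ScalarSpectralMeasure
import Mathlib.Analysis.SpecialFunctions.Pow.Continuity
import Mathlib.MeasureTheory.Integral.DominatedConvergence
import HarnessLib

/-!
# The Laplace representation of the OS semigroup: `⟪ψ, e^{-sH} ψ⟫ = ∫ λ^s dμ_ψ(λ)`

Osterwalder–Schrader I (CMP 31 (1973)), §4.1, p. 92: "`T^t … = e^{-tH}`, where `H ≥ 0` … The
family `T^τ`, `τ = t + is`, is a holomorphic semigroup for `Re τ > 0`, uniformly bounded and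
strongly continuous for `Re τ ≥ 0`." The classical proof is the spectral theorem:
`⟪ψ, e^{-τH} ψ⟫ = ∫ e^{-τE} dν_ψ(E)`. Mathlib has no spectral theorem for the unbounded `H`, but
the bounded positive contraction `e^{-H} = shiftH hE2 1` has scalar spectral measures
(`Literature.Analysis.OperatorTheory.scalarSpectralMeasure`, from the continuous functional
calculus and the Riesz–Markov–Kakutani theorem), and in the variable `λ = e^{-E} ∈ [0, 1]` the
Laplace representation reads `⟪ψ, e^{-sH} ψ⟫ = ∫_{σ(e^{-H})} λ^s dμ_ψ(λ)`. This file proves it for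
all real `s > 0`:

* `osSpectralMeasure hE1 ψ` — `μ_ψ`, the scalar spectral measure of `e^{-H}` at `ψ` (finite, total
  mass `‖ψ‖²`, carried by `σ(e^{-H}) ⊆ [0, 1]`, `spectrum_shiftH_subset_Icc`);
* `inner_shiftH_dyadic_eq_integral` — the formula for dyadic `s = (m+1)/2ᵏ`, where
  `e^{-sH} = (e^{-H})^s` is an identity in the functional calculus
  (`OSDistributionSpacePowers`);
* `continuousOn_integral_rpow_osSpectralMeasure` — `s ↦ ∫ λ^s dμ_ψ` is continuous on `(0, ∞)`
  (dominated convergence, `|λ^s| ≤ 1`);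
* `inner_shiftH_eq_integral` — **the Laplace representation for all real `s > 0`**, by the
  strong continuity of `e^{-sH}` (`OSDistributionSpaceSemigroup`) and dyadic approximation
  `(⌊s 2ᵏ⌋ + 1)/2ᵏ ↓ s`.

The right-hand side is visibly the restriction to the positive real axis of a function
holomorphic in `Re τ > 0` and bounded by `‖ψ‖²` — OS's `T^τ` on the diagonal; polarization and
the boundary group are the next step.

## References
* K. Osterwalder, R. Schrader, Axioms for Euclidean Green's functions, CMP 31 (1973), §4.1,
  p. 92 (text between (4.9) and (4.10)).
* M. Reed, B. Simon, Methods of Modern Mathematical Physics I (rev. ed. 1980), §VII.2 (spectral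
  measures `μ_ψ`).
-/

noncomputable section

open MeasureTheory Filter
open _root_.Topology
open scoped InnerProductSpace NNReal

-- CFC instance chain on `ℋ →L[ℂ] ℋ` (see `OSDistributionSpacePowers`).
set_option synthInstance.maxHeartbeats 200000

namespace Literature.MathematicalPhysics.QuantumFieldTheory

variable {d : ℕ} [NeZero d]

section SchwingerFamily
open Literature.MathematicalPhysics.QuantumLattice (SchwingerFamily)
open Literature.MathematicalPhysics.QuantumLattice.SchwingerFamily
open Literature.MathematicalPhysics.QuantumLattice.SchwingerFamily.OSSpace
open Literature.Analysis.OperatorTheory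

variable {𝔖 : SchwingerFamily (EuclideanSpace ℝ (Fin d))} {hE2 : 𝔖.IsOSReflectionPositive}

/-- **The spectrum of `e^{-tH}` lies in `[0, 1]`**: `e^{-tH}` is a positive contraction
(`0 ≤ e^{-tH}`, `‖e^{-tH}‖ ≤ 1`; Osterwalder–Schrader I (1973), p. 92: `H ≥ 0`). [cite: OsterwalderSchraderCMP1973, §4.1 p. 92] -/
theorem _root_.Literature.MathematicalPhysics.QuantumLattice.SchwingerFamily.OSSpace.spectrum_shiftH_subset_Icc (hE1 : 𝔖.IsEuclideanCovariant) (t : ℝ) :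
    spectrum ℝ (shiftH hE2 t) ⊆ Set.Icc 0 1 := by
  intro x hx
  refine ⟨spectrum_nonneg_of_nonneg (shiftH_nonneg hE1 t) hx, ?_⟩
  -- `x ∈ σ_ℝ(T) ⇒ (x : ℂ) ∈ σ_ℂ(T) ⇒ |x| ≤ ‖T‖ ‖1‖ ≤ 1`
  have hxC : (algebraMap ℝ ℂ x) ∈ spectrum ℂ (shiftH hE2 t) :=
    (spectrum.algebraMap_mem_iff ℂ).2 hx
  have h := spectrum.norm_le_norm_mul_of_mem hxC
  have h1 : ‖(1 : OSHilbert 𝔖 hE2 →L[ℂ] OSHilbert 𝔖 hE2)‖ ≤ 1 := ContinuousLinearMap.norm_id_le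
  have h2 : ‖algebraMap ℝ ℂ x‖ = |x| := by simp
  rw [h2] at h
  calc x ≤ |x| := le_abs_self x
    _ ≤ ‖shiftH hE2 t‖ * ‖(1 : OSHilbert 𝔖 hE2 →L[ℂ] OSHilbert 𝔖 hE2)‖ := h
    _ ≤ 1 * 1 := mul_le_mul (opNorm_shiftH_le hE1 t) h1 (norm_nonneg _) zero_le_one
    _ = 1 := mul_one 1

/-- **The OS spectral measure `μ_ψ`** of a vector `ψ ∈ ℋ`: the scalar spectral measure of the
positive contraction `e^{-H} = shiftH hE2 1` at `ψ` (Reed–Simon I §VII.2), a finite measure on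
`σ(e^{-H}) ⊆ [0, 1]`; in the variable `λ = e^{-E}` it is the spectral measure `dν_ψ(E)` of the
Hamiltonian used by Osterwalder–Schrader I (1973), p. 92. [cite: OsterwalderSchraderCMP1973, §4.1 p. 92] -/
def _root_.Literature.MathematicalPhysics.QuantumLattice.SchwingerFamily.OSSpace.osSpectralMeasure (hE1 : 𝔖.IsEuclideanCovariant) (ψ : OSHilbert 𝔖 hE2) :
    Measure (spectrum ℝ (shiftH hE2 (1 : ℝ))) :=
  scalarSpectralMeasure (shiftH hE2 1) (isSelfAdjoint_shiftH hE1 1) ψ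

/-- `μ_ψ` is a finite measure. [folklore] -/
instance _root_.Literature.MathematicalPhysics.QuantumLattice.SchwingerFamily.OSSpace.instIsFiniteMeasureOsSpectralMeasure (hE1 : 𝔖.IsEuclideanCovariant) (ψ : OSHilbert 𝔖 hE2) :
    IsFiniteMeasure (osSpectralMeasure hE1 ψ) := by
  unfold osSpectralMeasure; infer_instance

/-- Total mass `μ_ψ(σ(e^{-H})) = ‖ψ‖²`. [folklore] -/
theorem _root_.Literature.MathematicalPhysics.QuantumLattice.SchwingerFamily.OSSpace.osSpectralMeasure_univ_real (hE1 : 𝔖.IsEuclideanCovariant) (ψ : OSHilbert 𝔖 hE2) :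
    (osSpectralMeasure hE1 ψ).real Set.univ = ‖ψ‖ ^ 2 :=
  scalarSpectralMeasure_univ_real _ _ ψ

/-- Points of the spectrum of `e^{-H}` have coordinates in `[0, 1]`. [folklore] -/
theorem _root_.Literature.MathematicalPhysics.QuantumLattice.SchwingerFamily.OSSpace.coe_mem_Icc_of_mem_spectrum_shiftH (hE1 : 𝔖.IsEuclideanCovariant)
    (x : spectrum ℝ (shiftH hE2 (1 : ℝ))) : (x : ℝ) ∈ Set.Icc (0 : ℝ) 1 :=
  spectrum_shiftH_subset_Icc hE1 1 x.2

/-- **Laplace representation on dyadic times**: for `s = (m+1)/2ᵏ`,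
`⟪ψ, e^{-sH} ψ⟫ = ∫ λ^s dμ_ψ(λ)` — `e^{-sH} = (e^{-H})^s` in the functional calculus
(`shiftH_dyadic_eq_nnrpow'`) and the power formula for scalar spectral measures
(`inner_nnrpow_eq_integral`). [cite: OsterwalderSchraderCMP1973, §4.1 p. 92] -/
theorem _root_.Literature.MathematicalPhysics.QuantumLattice.SchwingerFamily.OSSpace.inner_shiftH_dyadic_eq_integral (hE1 : 𝔖.IsEuclideanCovariant) (ψ : OSHilbert 𝔖 hE2) (m k : ℕ) :
    ⟪ψ, shiftH hE2 ((m + 1 : ℕ) / 2 ^ k : ℝ) ψ⟫_ℂ =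
      ((∫ x, (x : ℝ) ^ ((m + 1 : ℕ) / 2 ^ k : ℝ) ∂(osSpectralMeasure hE1 ψ) : ℝ) : ℂ) := by
  have h1 := shiftH_dyadic_eq_nnrpow' (hE2 := hE2) hE1 zero_le_one m k
  rw [mul_one] at h1
  have hpos : 0 < ((m : ℝ≥0) + 1) * (2⁻¹ : ℝ≥0) ^ k := by positivity
  rw [h1, inner_nnrpow_eq_integral (shiftH_nonneg hE1 1) ψ hpos]
  have hexp : ((((m : ℝ≥0) + 1) * (2⁻¹ : ℝ≥0) ^ k : ℝ≥0) : ℝ) = ((m + 1 : ℕ) / 2 ^ k : ℝ) := by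
    push_cast
    rw [inv_pow, div_eq_mul_inv]
  rw [hexp]
  rfl

/-- The integrand bound: `|λ^s| ≤ 1` on the spectrum of `e^{-H}` for `s ≥ 0`. [folklore] -/
theorem _root_.Literature.MathematicalPhysics.QuantumLattice.SchwingerFamily.OSSpace.abs_rpow_le_one_of_mem_spectrum_shiftH (hE1 : 𝔖.IsEuclideanCovariant)
    (x : spectrum ℝ (shiftH hE2 (1 : ℝ))) {s : ℝ} (hs : 0 ≤ s) : |(x : ℝ) ^ s| ≤ 1 := by
  obtain ⟨h0, h1⟩ := coe_mem_Icc_of_mem_spectrum_shiftH hE1 x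
  rw [abs_of_nonneg (Real.rpow_nonneg h0 s)]
  exact Real.rpow_le_one h0 h1 hs

/-- **Continuity of the Laplace integral** `s ↦ ∫ λ^s dμ_ψ(λ)` on `(0, ∞)` (dominated
convergence: `|λ^s| ≤ 1` on `σ(e^{-H}) ⊆ [0, 1]`, `μ_ψ` finite, `s ↦ λ^s` continuous at `s > 0`
for every `λ ≥ 0`). [folklore] -/
theorem _root_.Literature.MathematicalPhysics.QuantumLattice.SchwingerFamily.OSSpace.continuousAt_integral_rpow_osSpectralMeasure (hE1 : 𝔖.IsEuclideanCovariant) (ψ : OSHilbert 𝔖 hE2)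
    {s₀ : ℝ} (hs₀ : 0 < s₀) :
    ContinuousAt (fun s : ℝ => ∫ x, (x : ℝ) ^ s ∂(osSpectralMeasure hE1 ψ)) s₀ := by
  have hmeas : ∀ s : ℝ, 0 < s →
      AEStronglyMeasurable (fun x : spectrum ℝ (shiftH hE2 (1 : ℝ)) => (x : ℝ) ^ s)
        (osSpectralMeasure hE1 ψ) := fun s hs =>
    (continuous_subtype_val.rpow_const fun x => Or.inr hs.le).aestronglyMeasurable
  refine continuousAt_of_dominated (bound := fun _ => 1) ?_ ?_ (integrable_const 1) ?_
  · filter_upwards [Ioi_mem_nhds hs₀] with s hs using hmeas s hs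
  · filter_upwards [Ioi_mem_nhds hs₀] with s hs
    exact Eventually.of_forall fun x => by
      rw [Real.norm_eq_abs]
      exact abs_rpow_le_one_of_mem_spectrum_shiftH hE1 x (le_of_lt hs)
  · exact Eventually.of_forall fun x => Real.continuousAt_const_rpow' hs₀.ne'

/-- Dyadic approximation from above: `(⌊s 2ᵏ⌋₊ + 1)/2ᵏ → s`. [folklore] -/
theorem tendsto_nat_floor_succ_div_two_pow {s : ℝ} (hs : 0 ≤ s) :
    Tendsto (fun k : ℕ => ((⌊s * 2 ^ k⌋₊ + 1 : ℕ) / 2 ^ k : ℝ)) atTop (𝓝 s) := by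
  have hlow : ∀ k : ℕ, s ≤ ((⌊s * 2 ^ k⌋₊ + 1 : ℕ) / 2 ^ k : ℝ) := fun k => by
    rw [le_div_iff₀ (by positivity)]
    push_cast
    exact (Nat.lt_floor_add_one (s * 2 ^ k)).le
  have hup : ∀ k : ℕ, ((⌊s * 2 ^ k⌋₊ + 1 : ℕ) / 2 ^ k : ℝ) ≤ s + (2⁻¹ : ℝ) ^ k := fun k => by
    rw [div_le_iff₀ (by positivity), add_mul, inv_pow, inv_mul_cancel₀ (by positivity)]
    push_cast
    gcongr
    exact Nat.floor_le (by positivity)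
  have hlim : Tendsto (fun k : ℕ => s + (2⁻¹ : ℝ) ^ k) atTop (𝓝 s) := by
    have := (tendsto_pow_atTop_nhds_zero_of_lt_one (r := (2⁻¹ : ℝ)) (by norm_num) (by norm_num))
    simpa using this.const_add s
  exact tendsto_of_tendsto_of_tendsto_of_le_of_le tendsto_const_nhds hlim hlow hup

/-- **The Laplace representation of the OS semigroup** (Osterwalder–Schrader I (1973), §4.1,
p. 92: `T^t = e^{-tH}` with `H ≥ 0` self-adjoint; here in the variable `λ = e^{-E}`): for every
`ψ ∈ ℋ` and every real `s > 0`,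
`⟪ψ, e^{-sH} ψ⟫ = ∫_{σ(e^{-H})} λ^s dμ_ψ(λ)`,
with the finite positive measure `μ_ψ` on `σ(e^{-H}) ⊆ [0, 1]`. Both sides are continuous in `s`
(strong continuity of the semigroup; dominated convergence) and agree on the dyadic rationals.
This replaces the spectral theorem for the unbounded `H` in all matrix-element statements about
`e^{-τH}`. [cite: OsterwalderSchraderCMP1973, §4.1 p. 92] -/
theorem _root_.Literature.MathematicalPhysics.QuantumLattice.SchwingerFamily.OSSpace.inner_shiftH_eq_integral (hE1 : 𝔖.IsEuclideanCovariant) (ψ : OSHilbert 𝔖 hE2) {s : ℝ} (hs : 0 < s) :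
    ⟪ψ, shiftH hE2 s ψ⟫_ℂ = ((∫ x, (x : ℝ) ^ s ∂(osSpectralMeasure hE1 ψ) : ℝ) : ℂ) := by
  set q : ℕ → ℝ := fun k => ((⌊s * 2 ^ k⌋₊ + 1 : ℕ) / 2 ^ k : ℝ) with hq
  have hq_tendsto : Tendsto q atTop (𝓝 s) := tendsto_nat_floor_succ_div_two_pow hs.le
  -- both sides along the dyadic sequence
  have hL : Tendsto (fun k => ⟪ψ, shiftH hE2 (q k) ψ⟫_ℂ) atTop (𝓝 ⟪ψ, shiftH hE2 s ψ⟫_ℂ) :=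
    ((continuous_inner_shiftH hE1 ψ ψ).tendsto s).comp hq_tendsto
  have hR : Tendsto (fun k => (((∫ x, (x : ℝ) ^ (q k) ∂(osSpectralMeasure hE1 ψ)) : ℝ) : ℂ)) atTop
      (𝓝 (((∫ x, (x : ℝ) ^ s ∂(osSpectralMeasure hE1 ψ)) : ℝ) : ℂ)) :=
    ((Complex.continuous_ofReal.continuousAt.comp
      (continuousAt_integral_rpow_osSpectralMeasure hE1 ψ hs)).tendsto).comp hq_tendsto
  have heq : (fun k => ⟪ψ, shiftH hE2 (q k) ψ⟫_ℂ) =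
      fun k => (((∫ x, (x : ℝ) ^ (q k) ∂(osSpectralMeasure hE1 ψ)) : ℝ) : ℂ) :=
    funext fun k => inner_shiftH_dyadic_eq_integral hE1 ψ _ k
  rw [heq] at hL
  exact tendsto_nhds_unique hL hR

/-- Real form of the Laplace representation: `Re ⟪ψ, e^{-sH} ψ⟫ = ∫ λ^s dμ_ψ(λ)`, `s > 0`. [folklore] -/
theorem _root_.Literature.MathematicalPhysics.QuantumLattice.SchwingerFamily.OSSpace.re_inner_shiftH_eq_integral (hE1 : 𝔖.IsEuclideanCovariant) (ψ : OSHilbert 𝔖 hE2) {s : ℝ} (hs : 0 < s) :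
    RCLike.re ⟪ψ, shiftH hE2 s ψ⟫_ℂ = ∫ x, (x : ℝ) ^ s ∂(osSpectralMeasure hE1 ψ) := by
  rw [inner_shiftH_eq_integral hE1 ψ hs]
  simp only [RCLike.re_to_complex, Complex.ofReal_re]

end SchwingerFamily

end Literature.MathematicalPhysics.QuantumFieldTheory
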